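import Summits.QuantumFields.BalabanUV.Beta.RemainderExplicitHistoryDiagonalProfile

/-!
# RemainderExplicitHistoryDiagonalMonotone — ROAD P3: THE ORDER-0 PROFILE FAMILY IS MONOTONE IN THE CUTOFF — for two infrared-pinned runs of
# `β_{k+1} = b + Σ_{i≤k} ρ(k−i)·min(g_k, |g_k − g_i|)` (A: `K` steps, B: `K + 1` steps) one has `1∕(g^A_j)² ≤ 1∕(g^B_{j+1})²` at EVERY matched
# scale (a MAXIMUM PRINCIPLE along the matched recursion: the extra ultraviolet coupling only adds to B's β, and the history feedback
# carries monotone weights), so `invSq g m n` is NON-DECREASING in the cutoff, the diagonal sums TELESCOPE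
# (`Σ_{n<N} disc = invSq g m N − invSq g m 0 ≤ m·W·γ`), and the continuum coupling EXISTS with NO smallness of the feedback at all
# (ninth file of station S-d4p3-g47-1; no rate, no NE4 as typed, no fading memory)

Cell `pub-balaban`, β-function sub-cell, BINDER row D4 «RemainderConst leaves for Bałaban's split» (`HOME/BINDER-OWNERS.md`; owner
lineage `b2b-balaban-beta-an4`; this file by co-owner #3 lineage `b2b-balaban-beta-d4-p3`, road P3 «the reduction road», generation 47,
station S-d4p3-g47-1, ninth file; imports the station's closing file `RemainderExplicitHistoryDiagonalProfile` (hence road P3's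
`RemainderExplicitHistoryHalfMomentWitness`, (E30)'s `run_mono`, and `…DiagonalExistence` ∕ `…DiagonalCauchy`)), β-FLOW TEAM duty (1);
FREEZE (0) honoured (def-free module in road P3's own `RemainderExplicit*` series; no leaf, no interface, no Literature file).  SOURCE OF THE
SHAPES ONLY: [Balaban1987RG1] (0.20) p. 256, (0.31) and Thm 2 p. 259, §5 p. 298.  Pure real analysis about ONE explicit toy family (ours).

HONEST FRAMING (page 1 of everything the β sub-cell writes).  *"Discharging BetaPertH makes Bałaban's UV stability UNCONDITIONAL —
a real constructive-QFT result; it is NOT the continuum limit and NOT the Clay problem."*  THIS FILE DISCHARGES NOTHING OF THE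
KIND.  It is a structural fact about road P3's ORDER-0 PROFILE FAMILY (generation 44), found while asking whether the station's diagonal
bound `m·γW∕(1 − 2Wγ∕b)` is sharp in `m`: along two pinned runs, with `d_j := 1∕(g^A_j)² − 1∕(g^B_{j+1})²` and `e_j := g^B_{j+1} − g^A_j`, the
matched recursion reads EXACTLY `d_j = d_{j+1} − ρ(j+1)·(g^B_{j+1} − g^B_0) − Σ_{i≤j} ρ(j−i)·(e_j − e_i)` (§1); where `d` is maximal and
`≥ 0`, every `e_j − e_i` is `≥ 0` (the conversion weight between `d` and `e` is non-decreasing along the increasing runs), so `d_j ≤ d_{j+1}`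
and the maximum propagates to the infrared pin where `d_K = 0` (§2): `d ≤ 0` EVERYWHERE.  Consequences (§3): at fixed infrared distance the
recursion variables are NON-DECREASING in the cutoff; the station's diagonal sums are TELESCOPIC, `Σ_{n<N} disc = invSq g m N − invSq g m 0
≤ m·W·γ`; the continuum coupling of every pinned family exists by MONOTONE CONVERGENCE with NO smallness hypothesis on the feedback (the
station's `2Wγ < b` is not needed; the box condition only enters the EXISTENCE of runs, `runFamily_exists`); node U6's Cauchy sum follows
(`cauchySum_of_diag_le`); and the station's m-uniformity question becomes the EXACT identity `Σ_n disc = astar g m − invSq g m 0`.  Nothing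
of Bałaban's (1.22) is asserted or constructed; row D4 class UNCHANGED (critical-path width 0; instance 0∕1; D4 DISCHARGE NO DATE); NOT
B12 Thm 2, NOT BetaPertH, NOT continuum, NOT Clay.  HONEST DEPENDENCY: continuum YM on T⁴ ⇐ BetaPertH ∧ nine spine estimates (0/9
proved); BetaPertH ⇐ (D1) ∧ (D4) ∧ CAP+tail; G-an2-4 gates asym, D1 and NE2/3/4.  ABSOLUTE RULE: nothing is cited as a fact.

WHAT IS PROVED ([folklore]; 0 sorry; 0 `def`; the family as the hypothesis `hβ` on an abstract `β : FlowStep.HBeta`, profile `ρ ≥ 0`, `b > 0`).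
* §1 `beta_pos_of_pos` (positive arguments ⟹ `β ≥ b > 0`), `run_mono_orderZero` ((E30) `run_mono` BY NAME), `beta_prefix_run`
  (`β j (g_0..g_j) = b + Σ_{i≤j} ρ(j−i)(g_j − g_i)` on a run), **`disc_signed_step`** (the EXACT matched recursion),
  `coupling_gap_monotone` (`d ≤ d′`, `0 ≤ d′`, `a ≤ a′`, `c ≤ c′` ⟹ `c − a ≤ c′ − a′`).
* §2 **`invSq_le_invSq_succ_run`** (MAXIMUM PRINCIPLE: `1∕(g^A_j)² ≤ 1∕(g^B_{j+1})²` for all `j ≤ K`).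
* §3 FOR A PINNED FAMILY OF RUNS (`ρ ≥ 0`, `Σ_{a<n} ρ_a ≤ W`, couplings in ]0,γ]; NO smallness): **`invSq_mono`**, `invSq_le_affine`
  (`invSq g m n ≤ 1∕g_IR² + m·(b + Wγ)`), `prof_le_invSq_orderZero` (`≥ 1∕g_IR² + m·b`), **`sum_disc_eq`** (TELESCOPING),
  **`sum_disc_le_linear`** (`≤ m·W·γ`), **`continuum_monotone`** (existence + the read-outs of `…DiagonalExistence` §1 + node U6's Cauchy sum,
  `B m = m·W·γ`), **`hasSum_disc`** (`Σ_n disc = astar g m − invSq g m 0`, the exact m-uniformity criterion).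
All letters NOT-IN-PRINT; `BetaFlowAsPrinted S` records a Markov β_n only ⇒ no junction of the as-printed interface changes.
-/

noncomputable section

open Finset Filter Topology

namespace Summit.QuantumFields.BalabanUV.Beta.RemainderExplicitHistoryDiagonalMonotone

open Literature.MathematicalPhysics.QuantumFieldTheory.Balaban1983to89
open Literature.MathematicalPhysics.QuantumFieldTheory.Balaban1983to89.FlowStep
open Literature.MathematicalPhysics.QuantumFieldTheory.Balaban1983to89.T4CouplingMatching
open Literature.MathematicalPhysics.QuantumFieldTheory.Balaban1983to89.T4ContinuumCoupling
open Literature.MathematicalPhysics.QuantumFieldTheory.Balaban1983to89.T4CauchySum (delta MatchingModConstants genFun genFunLim)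
open Summit.QuantumFields.BalabanUV.Beta.EriceRemainderEnclosureHistoryTwoLoop (run_mono)
open Summit.QuantumFields.BalabanUV.Beta.RemainderExplicitHistoryDiagonalExistence
open Summit.QuantumFields.BalabanUV.Beta.RemainderExplicitHistoryDiagonalCauchy (cauchySum_of_diag_le sum_pow_mul_linear_le)
open Summit.QuantumFields.BalabanUV.Beta.RemainderExplicitHistoryDiagonalProfile (sum_fin_profile_eq)

variable {β : HBeta} {b γ W : ℝ} {ρ : ℕ → ℝ}

/-! ## §1 Along two pinned runs the matched recursion is exact -/

/-- At positive arguments the family is `≥ b` (every history term is `ρ(k−i)·min(p_k, ·) ≥ 0`). [folklore] -/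
theorem beta_pos_of_pos
    (hβ : ∀ (k : ℕ) (p : Fin (k + 1) → ℝ),
      β k p = b + ∑ i : Fin (k + 1), ρ (k - i) * min (p (Fin.last k)) (|p (Fin.last k) - p i|))
    (hρ0 : ∀ a, 0 ≤ ρ a) {k : ℕ} {p : Fin (k + 1) → ℝ} (hp : ∀ i, 0 < p i) : b ≤ β k p := by
  rw [hβ k p]
  have : 0 ≤ ∑ i : Fin (k + 1), ρ (k - i) * min (p (Fin.last k)) (|p (Fin.last k) - p i|) :=
    Finset.sum_nonneg fun i _ => mul_nonneg (hρ0 _) (le_min (hp _).le (abs_nonneg _))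
  linarith

/-- Runs of the family increase: `g_i ≤ g_k` for `i ≤ k ≤ K` ((E30) `run_mono` BY NAME, the sign from `beta_pos_of_pos`). [folklore] -/
theorem run_mono_orderZero
    (hβ : ∀ (k : ℕ) (p : Fin (k + 1) → ℝ),
      β k p = b + ∑ i : Fin (k + 1), ρ (k - i) * min (p (Fin.last k)) (|p (Fin.last k) - p i|))
    (hb : 0 < b) (hρ0 : ∀ a, 0 ≤ ρ a) {K : ℕ} {g : ℕ → ℝ} (h : RGEqH K β g) (hpos : ∀ k, k ≤ K → 0 < g k)
    {i k : ℕ} (hik : i ≤ k) (hk : k ≤ K) : g i ≤ g k :=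
  run_mono h hpos (fun l hl => hb.le.trans (beta_pos_of_pos hβ hρ0 fun i' =>
    hpos i' (by have := i'.isLt; omega))) hik hk

/-- ON A RUN THE `min` RESOLVES: `β j (g_0..g_j) = b + Σ_{i≤j} ρ(j−i)·(g_j − g_i)` for `j ≤ K`. [folklore] -/
theorem beta_prefix_run
    (hβ : ∀ (k : ℕ) (p : Fin (k + 1) → ℝ),
      β k p = b + ∑ i : Fin (k + 1), ρ (k - i) * min (p (Fin.last k)) (|p (Fin.last k) - p i|))
    (hb : 0 < b) (hρ0 : ∀ a, 0 ≤ ρ a) {K : ℕ} {g : ℕ → ℝ} (h : RGEqH K β g) (hpos : ∀ k, k ≤ K → 0 < g k)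
    {j : ℕ} (hj : j ≤ K) :
    β j (prefixOf g j) = b + ∑ i : Fin (j + 1), ρ (j - i) * (g j - g i) := by
  rw [hβ j]
  congr 1
  refine Finset.sum_congr rfl fun i _ => ?_
  have hi : (i : ℕ) ≤ j := Nat.lt_succ_iff.1 i.isLt
  have hle : g i ≤ g j := run_mono_orderZero hβ hb hρ0 h hpos hi hj
  have hgi := hpos i (hi.trans hj)
  simp only [prefixOf_apply, Fin.val_last]
  rw [abs_of_nonneg (by linarith), min_eq_right (by linarith)]

/-- **THE EXACT MATCHED RECURSION** for two runs of the family (A: `K` steps, B: `K + 1` steps, positive couplings): for `j < K`, with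
`d_j = 1∕(g^A_j)² − 1∕(g^B_{j+1})²`,
`d_j = d_{j+1} − ρ(j+1)·(g^B_{j+1} − g^B_0) − Σ_{i≤j} ρ(j−i)·((g^B_{j+1} − g^A_j) − (g^B_{i+1} − g^A_i))` — (0.20) for both runs, the resolved
`min`, and the stationary weights of the common couplings. [cite: Balaban1987RG1, (0.20) p.256] -/
theorem disc_signed_step
    (hβ : ∀ (k : ℕ) (p : Fin (k + 1) → ℝ),
      β k p = b + ∑ i : Fin (k + 1), ρ (k - i) * min (p (Fin.last k)) (|p (Fin.last k) - p i|))
    (hb : 0 < b) (hρ0 : ∀ a, 0 ≤ ρ a) {K : ℕ} {gA gB : ℕ → ℝ} (hA : RGEqH K β gA) (hB : RGEqH (K + 1) β gB)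
    (hApos : ∀ k, k ≤ K → 0 < gA k) (hBpos : ∀ k, k ≤ K + 1 → 0 < gB k) {j : ℕ} (hj : j < K) :
    1 / (gA j) ^ 2 - 1 / (gB (j + 1)) ^ 2
      = (1 / (gA (j + 1)) ^ 2 - 1 / (gB (j + 2)) ^ 2) - ρ (j + 1) * (gB (j + 1) - gB 0)
        - ∑ i : Fin (j + 1), ρ (j - i) * ((gB (j + 1) - gA j) - (gB (i + 1) - gA i)) := by
  have eA := hA j hj
  have eB := hB (j + 1) (by omega)
  rw [beta_prefix_run hβ hb hρ0 hA hApos hj.le] at eA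
  rw [beta_prefix_run hβ hb hρ0 hB hBpos (by omega : j + 1 ≤ K + 1), Fin.sum_univ_succ] at eB
  simp only [Fin.val_zero, Nat.sub_zero, Fin.val_succ, Nat.add_sub_add_right] at eB
  have e3 : ∑ i : Fin (j + 1), ρ (j - i) * ((gB (j + 1) - gA j) - (gB (i + 1) - gA i))
      = (∑ i : Fin (j + 1), ρ (j - i) * (gB (j + 1) - gB (i + 1))) - ∑ i : Fin (j + 1), ρ (j - i) * (gA j - gA i) := by
    rw [← Finset.sum_sub_distrib]
    exact Finset.sum_congr rfl fun i _ => by ring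
  rw [e3, eA, eB]
  ring

/-- THE CONVERSION WEIGHT IS MONOTONE: for `0 < a ≤ a′`, `0 < c ≤ c′` with `1∕a² − 1∕c² ≤ 1∕a′² − 1∕c′²` and `0 ≤ 1∕a′² − 1∕c′²`:
`c − a ≤ c′ − a′` (`c − a = (1∕a² − 1∕c²)·a²c²∕(a + c)` and `a²c²∕(a+c) = 1∕(1∕(ac²) + 1∕(a²c))` is non-decreasing in both). [folklore] -/
theorem coupling_gap_monotone {a a' c c' : ℝ} (ha : 0 < a) (hc : 0 < c) (haa : a ≤ a') (hcc : c ≤ c')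
    (hd : 1 / a ^ 2 - 1 / c ^ 2 ≤ 1 / a' ^ 2 - 1 / c' ^ 2) (hd' : 0 ≤ 1 / a' ^ 2 - 1 / c' ^ 2) : c - a ≤ c' - a' := by
  have ha' : 0 < a' := lt_of_lt_of_le ha haa
  have hc' : 0 < c' := lt_of_lt_of_le hc hcc
  -- `a′ ≤ c′` from `hd'`
  have hac' : a' ≤ c' := by
    have h1 : 1 / c' ^ 2 ≤ 1 / a' ^ 2 := by linarith
    have h2 := (one_div_le_one_div (pow_pos hc' 2) (pow_pos ha' 2)).mp h1
    nlinarith [ha', hc']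
  by_cases hca : c ≤ a
  · linarith
  · rw [not_le] at hca
    -- both gaps positive: compare through the weights
    have e1 : c - a = (1 / a ^ 2 - 1 / c ^ 2) * (a ^ 2 * c ^ 2 / (a + c)) := by
      field_simp
      ring
    have e2 : c' - a' = (1 / a' ^ 2 - 1 / c' ^ 2) * (a' ^ 2 * c' ^ 2 / (a' + c')) := by
      field_simp
      ring
    have hd0 : 0 ≤ 1 / a ^ 2 - 1 / c ^ 2 := by
      have := one_div_le_one_div_of_le (pow_pos ha 2) (pow_le_pow_left₀ ha.le hca.le 2)
      linarith
    -- the weight is non-decreasing: `a²c²∕(a+c) = 1 ∕ (1∕(a c²) + 1∕(a² c))`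
    have hw : a ^ 2 * c ^ 2 / (a + c) ≤ a' ^ 2 * c' ^ 2 / (a' + c') := by
      have ew : ∀ x y : ℝ, 0 < x → 0 < y → x ^ 2 * y ^ 2 / (x + y) = 1 / (1 / (x * y ^ 2) + 1 / (x ^ 2 * y)) := by
        intro x y hx hy
        field_simp
      rw [ew a c ha hc, ew a' c' ha' hc']
      have h1 : 1 / (a' * c' ^ 2) ≤ 1 / (a * c ^ 2) :=
        one_div_le_one_div_of_le (by positivity) (mul_le_mul haa (pow_le_pow_left₀ hc.le hcc 2) (sq_nonneg _) ha'.le)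
      have h2 : 1 / (a' ^ 2 * c') ≤ 1 / (a ^ 2 * c) :=
        one_div_le_one_div_of_le (by positivity) (mul_le_mul (pow_le_pow_left₀ ha.le haa 2) hcc hc.le (sq_nonneg _))
      exact one_div_le_one_div_of_le (by positivity) (add_le_add h1 h2)
    have hw0 : 0 ≤ a ^ 2 * c ^ 2 / (a + c) := by positivity
    rw [e1, e2]
    exact mul_le_mul hd hw hw0 hd'

/-! ## §2 The maximum principle: B's recursion variables dominate A's at every matched scale -/

/-- **MONOTONE IN THE CUTOFF (maximum principle).**  Two runs of the order-0 profile family (`b > 0`, `ρ ≥ 0`) — A: `K` steps, B: `K + 1`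
steps, positive couplings — pinned `g^A_K = g^B_{K+1}`: THEN `1∕(g^A_j)² ≤ 1∕(g^B_{j+1})²` for every `j ≤ K`.  (If `d = 1∕(g^A)² − 1∕(g^B_{·+1})²`
had a positive maximum at `j₀`, then at every argmax `j` with `d_j ≥ 0` the exact recursion gives `d_j ≤ d_{j+1}` — the scale-shift term is
`≤ 0` and every `e_j − e_i ≥ 0` by `coupling_gap_monotone` — so the maximum propagates to `j = K`, where the pin forces `d_K = 0`.)
[cite: Balaban1987RG1, (0.20) p.256 and Thm 2 p.259] -/
theorem invSq_le_invSq_succ_run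
    (hβ : ∀ (k : ℕ) (p : Fin (k + 1) → ℝ),
      β k p = b + ∑ i : Fin (k + 1), ρ (k - i) * min (p (Fin.last k)) (|p (Fin.last k) - p i|))
    (hb : 0 < b) (hρ0 : ∀ a, 0 ≤ ρ a) {K : ℕ} {gA gB : ℕ → ℝ} (hA : RGEqH K β gA) (hB : RGEqH (K + 1) β gB)
    (hApos : ∀ k, k ≤ K → 0 < gA k) (hBpos : ∀ k, k ≤ K + 1 → 0 < gB k) (hpin : gA K = gB (K + 1)) :
    ∀ j, j ≤ K → 1 / (gA j) ^ 2 ≤ 1 / (gB (j + 1)) ^ 2 := by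
  classical
  set d : ℕ → ℝ := fun j => 1 / (gA j) ^ 2 - 1 / (gB (j + 1)) ^ 2 with hd
  have hdK : d K = 0 := by simp [hd, hpin]
  -- the propagation step at an argmax with nonnegative value
  have hstep : ∀ j, j < K → (∀ i, i ≤ K → d i ≤ d j) → 0 ≤ d j → d j ≤ d (j + 1) := by
    intro j hj hmax hdj
    have e := disc_signed_step hβ hb hρ0 hA hB hApos hBpos hj
    have hs : 0 ≤ ρ (j + 1) * (gB (j + 1) - gB 0) :=
      mul_nonneg (hρ0 _) (by linarith [run_mono_orderZero hβ hb hρ0 hB hBpos (Nat.zero_le (j + 1)) (by omega)])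
    have hsum : 0 ≤ ∑ i : Fin (j + 1), ρ (j - i) * ((gB (j + 1) - gA j) - (gB (i + 1) - gA i)) := by
      refine Finset.sum_nonneg fun i _ => mul_nonneg (hρ0 _) ?_
      have hi : (i : ℕ) ≤ j := Nat.lt_succ_iff.1 i.isLt
      have hgap := coupling_gap_monotone (hApos i (by omega)) (hBpos (i + 1) (by omega))
        (run_mono_orderZero hβ hb hρ0 hA hApos hi hj.le)
        (run_mono_orderZero hβ hb hρ0 hB hBpos (by omega : (i : ℕ) + 1 ≤ j + 1) (by omega))
        (hmax i (by omega)) hdj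
      linarith
    show 1 / gA j ^ 2 - 1 / gB (j + 1) ^ 2 ≤ 1 / gA (j + 1) ^ 2 - 1 / gB (j + 1 + 1) ^ 2
    rw [e]
    linarith
  -- the argmax
  obtain ⟨j₀, hj₀, hmax₀⟩ := Finset.exists_max_image (range (K + 1)) d ⟨0, by simp⟩
  have hj₀K : j₀ ≤ K := Nat.lt_succ_iff.mp (Finset.mem_range.mp hj₀)
  have hmax : ∀ i, i ≤ K → d i ≤ d j₀ := fun i hi => hmax₀ i (Finset.mem_range.mpr (Nat.lt_succ_of_le hi))
  by_cases hpos : d j₀ ≤ 0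
  · intro j hj
    have := (hmax j hj).trans hpos
    show 1 / gA j ^ 2 ≤ 1 / gB (j + 1) ^ 2
    simp only [hd] at this
    linarith
  · rw [not_le] at hpos
    -- propagate the maximum to the pin
    have hprop : ∀ t, j₀ + t ≤ K → d j₀ ≤ d (j₀ + t) := by
      intro t
      induction t with
      | zero => intro _; simp
      | succ t ih =>
        intro ht
        have hjt : j₀ + t < K := by omega
        have h1 := ih hjt.le
        have hmax' : ∀ i, i ≤ K → d i ≤ d (j₀ + t) := fun i hi => (hmax i hi).trans h1
        have h2 := hstep (j₀ + t) hjt hmax' (hpos.le.trans h1)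
        rw [Nat.add_succ]
        exact h1.trans h2
    have hK := hprop (K - j₀) (by omega)
    rw [Nat.add_sub_cancel' hj₀K, hdK] at hK
    exact absurd hK (not_le.mpr hpos)

/-! ## §3 For a pinned family of runs: monotone cutoff sequences, telescoping diagonals, existence with no smallness -/

/-- **THE RECURSION VARIABLES ARE NON-DECREASING IN THE CUTOFF**: for a family of runs of the family in ]0,γ] pinned at one `g_IR`,
`invSq g m n ≤ invSq g m (n+1)` at every infrared distance `m` — hence `Monotone (invSq g m)`. [folklore] -/
theorem invSq_mono
    (hβ : ∀ (k : ℕ) (p : Fin (k + 1) → ℝ),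
      β k p = b + ∑ i : Fin (k + 1), ρ (k - i) * min (p (Fin.last k)) (|p (Fin.last k) - p i|))
    (hb : 0 < b) (hρ0 : ∀ a, 0 ≤ ρ a) {g : ℕ → ℕ → ℝ} {gIR : ℝ} (hrun : ∀ K, RGEqH K β (g K))
    (hbox : ∀ K i, i ≤ K → 0 < g K i ∧ g K i ≤ γ) (hpin : ∀ K, g K K = gIR) (m : ℕ) : Monotone (invSq g m) := by
  refine monotone_nat_of_le_succ fun n => ?_
  have h := invSq_le_invSq_succ_run hβ hb hρ0 (hrun (n + m)) (hrun (n + m + 1)) (fun k hk => (hbox _ k hk).1)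
    (fun k hk => (hbox _ k hk).1) ((hpin _).trans (hpin _).symm) n (Nat.le_add_right n m)
  simp only [invSq]
  rw [Nat.add_right_comm n 1 m]
  exact h

/-- On the box `β ≤ b + W·γ` (`ρ ≥ 0`, `Σ_{a<n} ρ_a ≤ W`), so along a pinned run `invSq g m n ≤ 1∕g_IR² + m·(b + Wγ)`. [folklore] -/
theorem invSq_le_affine
    (hβ : ∀ (k : ℕ) (p : Fin (k + 1) → ℝ),
      β k p = b + ∑ i : Fin (k + 1), ρ (k - i) * min (p (Fin.last k)) (|p (Fin.last k) - p i|))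
    (hρ0 : ∀ a, 0 ≤ ρ a) (hρW : ∀ n, ∑ a ∈ range n, ρ a ≤ W) {g : ℕ → ℕ → ℝ} {gIR : ℝ} (hrun : ∀ K, RGEqH K β (g K))
    (hbox : ∀ K i, i ≤ K → 0 < g K i ∧ g K i ≤ γ) (hpin : ∀ K, g K K = gIR) (m n : ℕ) :
    invSq g m n ≤ 1 / gIR ^ 2 + (m : ℝ) * (b + W * γ) := by
  have hW : 0 ≤ W := by simpa using hρW 0
  have hβle : ∀ k (p : Fin (k + 1) → ℝ), p ∈ Box γ k → β k p ≤ b + W * γ := by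
    intro k p hp
    rw [hβ k p]
    have hlamW : ∀ k, ∑ i : Fin (k + 1), (fun k i => ρ (k - i)) k i ≤ W := fun k => by
      simpa [sum_fin_profile_eq] using hρW (k + 1)
    have h1 := RemainderExplicitHistoryHalfMomentWitness.hist_le (γ := γ) (lam := fun k i => ρ (k - i)) (fun k i => hρ0 _) hlamW hp
    have h2 : W * p (Fin.last k) ≤ W * γ := mul_le_mul_of_nonneg_left (mem_box.mp hp _).2 hW
    linarith
  have htel := inv_sq_telescopeH (hrun (n + m)) (Nat.le_add_right n m) le_rfl
  rw [hpin] at htel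
  have hsum : ∑ j ∈ Ico n (n + m), β j (prefixOf (g (n + m)) j) ≤ (m : ℝ) * (b + W * γ) := by
    calc ∑ j ∈ Ico n (n + m), β j (prefixOf (g (n + m)) j) ≤ ∑ _j ∈ Ico n (n + m), (b + W * γ) :=
          Finset.sum_le_sum fun j hj => hβle j _ (prefixOf_mem_box (by have := (Finset.mem_Ico.mp hj).2; omega) (hbox (n + m)))
      _ = (m : ℝ) * (b + W * γ) := by rw [Finset.sum_const, Nat.card_Ico, Nat.add_sub_cancel_left, nsmul_eq_mul]
  simp only [invSq]
  linarith

/-- Along a pinned run `1∕g_IR² + m·b ≤ invSq g m n` (`T4ContinuumCoupling.prof_le_invSq` BY NAME with the family's floor `b ≤ β`). [folklore] -/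
theorem prof_le_invSq_orderZero
    (hβ : ∀ (k : ℕ) (p : Fin (k + 1) → ℝ),
      β k p = b + ∑ i : Fin (k + 1), ρ (k - i) * min (p (Fin.last k)) (|p (Fin.last k) - p i|))
    (hρ0 : ∀ a, 0 ≤ ρ a) {g : ℕ → ℕ → ℝ} {gIR : ℝ} (hrun : ∀ K, RGEqH K β (g K))
    (hbox : ∀ K i, i ≤ K → 0 < g K i ∧ g K i ≤ γ) (hpin : ∀ K, g K K = gIR) (m n : ℕ) :
    1 / gIR ^ 2 + b * m ≤ invSq g m n := by
  have hlo : BetaLowerH b γ β :=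
    RemainderExplicitHistoryHalfMomentWitness.lower (γ := γ) (lam := fun k i => ρ (k - i)) hβ (fun k i => hρ0 _)
  have h := prof_le_invSq hrun hbox hpin (eventualLowerH_of_betaLowerH hlo 0) (m := m) (Nat.zero_le n)
  simpa [prof] using h

/-- **THE DIAGONAL SUMS TELESCOPE**: `Σ_{n<N} disc (g (n+m)) (g (n+m+1)) n = invSq g m N − invSq g m 0` (each discrepancy is the
nonnegative increment `invSq g m (n+1) − invSq g m n` by `invSq_mono`). [folklore] -/
theorem sum_disc_eq
    (hβ : ∀ (k : ℕ) (p : Fin (k + 1) → ℝ),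
      β k p = b + ∑ i : Fin (k + 1), ρ (k - i) * min (p (Fin.last k)) (|p (Fin.last k) - p i|))
    (hb : 0 < b) (hρ0 : ∀ a, 0 ≤ ρ a) {g : ℕ → ℕ → ℝ} {gIR : ℝ} (hrun : ∀ K, RGEqH K β (g K))
    (hbox : ∀ K i, i ≤ K → 0 < g K i ∧ g K i ≤ γ) (hpin : ∀ K, g K K = gIR) (m N : ℕ) :
    ∑ n ∈ range N, disc (g (n + m)) (g (n + m + 1)) n = invSq g m N - invSq g m 0 := by
  have hmono := invSq_mono hβ hb hρ0 hrun hbox hpin m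
  have e : ∀ n, disc (g (n + m)) (g (n + m + 1)) n = invSq g m (n + 1) - invSq g m n := fun n => by
    rw [← abs_invSq_succ_sub, abs_of_nonneg (sub_nonneg.mpr (hmono (Nat.le_succ n)))]
  simp_rw [e]
  exact Finset.sum_range_sub (invSq g m) N

/-- **THE LINEAR DIAGONAL BOUND WITH NO SMALLNESS**: `Σ_{n<N} disc (g (n+m)) (g (n+m+1)) n ≤ m·W·γ` for every pinned family of runs of the
family in ]0,γ] (`ρ ≥ 0`, `Σρ ≤ W`) — compare the station's `sum_disc_le_orderZero` (`m·γW∕(1 − 2Wγ∕b)` under `2Wγ < b`). [folklore] -/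
theorem sum_disc_le_linear
    (hβ : ∀ (k : ℕ) (p : Fin (k + 1) → ℝ),
      β k p = b + ∑ i : Fin (k + 1), ρ (k - i) * min (p (Fin.last k)) (|p (Fin.last k) - p i|))
    (hb : 0 < b) (hρ0 : ∀ a, 0 ≤ ρ a) (hρW : ∀ n, ∑ a ∈ range n, ρ a ≤ W) {g : ℕ → ℕ → ℝ} {gIR : ℝ}
    (hrun : ∀ K, RGEqH K β (g K)) (hbox : ∀ K i, i ≤ K → 0 < g K i ∧ g K i ≤ γ) (hpin : ∀ K, g K K = gIR) (m N : ℕ) :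
    ∑ n ∈ range N, disc (g (n + m)) (g (n + m + 1)) n ≤ (m : ℝ) * W * γ := by
  rw [sum_disc_eq hβ hb hρ0 hrun hbox hpin]
  have h1 := invSq_le_affine hβ hρ0 hρW hrun hbox hpin m N
  have h2 := prof_le_invSq_orderZero hβ hρ0 hrun hbox hpin m 0
  nlinarith

/-- **ROAD P3 — THE CONTINUUM COUPLING OF THE ORDER-0 PROFILE FAMILY EXISTS WITH NO SMALLNESS OF THE FEEDBACK** (monotone convergence;
the read-outs of `RemainderExplicitHistoryDiagonalExistence` with `B m = m·W·γ`): `invSq g m n → astar g m` with `|invSq g m n − astar g m|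
≤ m·W·γ`, couplings → `gstar g m ∈ ]0,γ]`, `gstar g 0 = g_IR`, diagonal β-values → `bstar g m ≥ b`, limit flow, `gstar_m ≤ 1∕√(1∕g_IR² + b·m)`;
and node U6's transported totals are summable for every contraction `0 ≤ ρ₁ < 1`, `E ≥ 0` (`summable_delta_of_diag_le`).
[cite: Balaban1987RG1, (0.20) p.256, (0.31) and Thm 2 p.259] -/
theorem continuum_monotone
    (hβ : ∀ (k : ℕ) (p : Fin (k + 1) → ℝ),
      β k p = b + ∑ i : Fin (k + 1), ρ (k - i) * min (p (Fin.last k)) (|p (Fin.last k) - p i|))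
    (hb : 0 < b) (hγ : 0 < γ) (hρ0 : ∀ a, 0 ≤ ρ a) (hρW : ∀ n, ∑ a ∈ range n, ρ a ≤ W) {g : ℕ → ℕ → ℝ} {gIR : ℝ}
    (hrun : ∀ K, RGEqH K β (g K)) (hbox : ∀ K i, i ≤ K → 0 < g K i ∧ g K i ≤ γ) (hpin : ∀ K, g K K = gIR) :
    (∀ m, Tendsto (invSq g m) atTop (𝓝 (astar g m))) ∧ (∀ m n, |invSq g m n - astar g m| ≤ (m : ℝ) * W * γ)
      ∧ (∀ m, Tendsto (fun n => g (n + m) n) atTop (𝓝 (gstar g m))) ∧ (∀ m, 0 < gstar g m ∧ gstar g m ≤ γ) ∧ gstar g 0 = gIR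
      ∧ (∀ m, Tendsto (fun n => β n (prefixOf (g (n + m + 1)) n)) atTop (𝓝 (bstar g m)))
      ∧ (∀ m, 1 / (gstar g (m + 1)) ^ 2 = 1 / (gstar g m) ^ 2 + bstar g m) ∧ (∀ m, b ≤ bstar g m)
      ∧ (∀ m, gstar g m ≤ 1 / sprof gIR b m)
      ∧ (∀ E ρ₁ : ℝ, 0 ≤ E → 0 ≤ ρ₁ → ρ₁ < 1 → Summable (delta E ρ₁ (fun K j => disc (g K) (g (K + 1)) j))) := by
  have hB : ∀ m N, ∑ n ∈ range N, disc (g (n + m)) (g (n + m + 1)) n ≤ (fun m => (m : ℝ) * W * γ) m :=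
    fun m N => sum_disc_le_linear hβ hb hρ0 hρW hrun hbox hpin m N
  have hlo : BetaLowerH b γ β :=
    RemainderExplicitHistoryHalfMomentWitness.lower (γ := γ) (lam := fun k i => ρ (k - i)) hβ (fun k i => hρ0 _)
  have hW : 0 ≤ W := by simpa using hρW 0
  refine ⟨tendsto_invSq_of_diag_le hB, abs_invSq_sub_astar_le_of_diag_le hB, tendsto_coupling_of_diag_le hB hbox,
    fun m => ⟨(gstar_pos_le_of_diag_le hB hbox m).1, (gstar_pos_le_of_diag_le hB hbox m).2.1⟩,
    gstar_zero_of_diag_le hB hbox hpin, tendsto_beta_diag_of_diag_le hB hrun, gstar_flow_of_diag_le hB hbox,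
    le_bstar_of_diag_le hB hrun hbox hlo, fun m => (gstar_le_inv_sprof_of_diag_le hB hrun hbox hpin hlo hb.le m).2,
    fun E ρ₁ hE hρ₁0 hρ₁1 => ?_⟩
  refine RemainderExplicitHistoryDiagonalCauchy.summable_delta_of_diag_le hE hρ₁0 hB
    (T := W * γ * ∑' n : ℕ, ((n : ℝ) + 1) ^ 1 * ρ₁ ^ n) fun L => ?_
  have h := sum_pow_mul_linear_le (C := W * γ) hρ₁0 hρ₁1 (mul_nonneg hW hγ.le) L
  refine le_trans (le_of_eq (Finset.sum_congr rfl fun m _ => ?_)) h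
  ring

/-- **THE EXACT m-UNIFORMITY CRITERION**: the diagonal series HAS SUM `astar g m − invSq g m 0` — so the station's diagonal sums are bounded
UNIFORMLY in `m` iff `sup_m (astar g m − 1∕(g^{(m)}_0)²) < ∞` (the continuum recursion variable at infrared distance `m` minus the
ultraviolet-most lattice one of the run with exactly `m` steps). [folklore] -/
theorem hasSum_disc
    (hβ : ∀ (k : ℕ) (p : Fin (k + 1) → ℝ),
      β k p = b + ∑ i : Fin (k + 1), ρ (k - i) * min (p (Fin.last k)) (|p (Fin.last k) - p i|))
    (hb : 0 < b) (hρ0 : ∀ a, 0 ≤ ρ a) (hρW : ∀ n, ∑ a ∈ range n, ρ a ≤ W) {g : ℕ → ℕ → ℝ} {gIR : ℝ}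
    (hrun : ∀ K, RGEqH K β (g K)) (hbox : ∀ K i, i ≤ K → 0 < g K i ∧ g K i ≤ γ) (hpin : ∀ K, g K K = gIR) (m : ℕ) :
    HasSum (fun n => disc (g (n + m)) (g (n + m + 1)) n) (astar g m - invSq g m 0) := by
  have hB : ∀ m N, ∑ n ∈ range N, disc (g (n + m)) (g (n + m + 1)) n ≤ (fun m => (m : ℝ) * W * γ) m :=
    fun m N => sum_disc_le_linear hβ hb hρ0 hρW hrun hbox hpin m N
  have ht := tendsto_invSq_of_diag_le hB m
  rw [hasSum_iff_tendsto_nat_of_nonneg (fun n => disc_nonneg _ _ _)]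
  have e : (fun N => ∑ n ∈ range N, disc (g (n + m)) (g (n + m + 1)) n) = fun N => invSq g m N - invSq g m 0 :=
    funext fun N => sum_disc_eq hβ hb hρ0 hrun hbox hpin m N
  rw [e]
  exact ht.sub_const _

end Summit.QuantumFields.BalabanUV.Beta.RemainderExplicitHistoryDiagonalMonotone

end
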